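import Literature.AlgebraicGeometry.ShimuraVarieties.UnitaryShimuraCurveCentralTranslate
import Literature.NumberTheory.Automorphic.Liu2021.AppendixC.EtaleHeckeCentralTrivial
import Literature.NumberTheory.Automorphic.UnitaryGroupFinAdelicOneLevelFinite
import Literature.RepresentationTheory.RepresentationBaseChangeFixedVectors
import Summits.HodgeConjecture.CorCM.HypLiu418.A3Liu418GSInstance
import HarnessLib

/-!
# The action of the finite-adelic centre `Z = E¹(𝔸_{F⁺,f})` on `H¹_ét` of the GS curve tower: the rational centre acts
# trivially, stabilisers are of finite index and open, occurring central characters are automorphic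

Summit `HodgeConjecture`, sub-problem `CorCM`, crux `HLiu418`, line `a3_liu418` (GS-6, the see-saw decomposition at the face of
the Gan–Savin record); namespace `Summit.HodgeConjecture.CorCM.Lines.A3Liu418`.  Two `def`s with body (`rhoEtCenterGS`,
`rhoEtCenterGSExt` — the central action on `H¹_ét` and its extension of scalars) and THEOREMS; no named fact, no instance, no `sorry`.
Imports the GS instance `A3Liu418GSInstance` (`sec42DataGS`, `etaleHeckeDatumGS`, `isInducedBy_etaleHeckeDatumGS`) and the
Literature leaves `UnitaryShimuraCurveCentralTranslate` (the rational centre acts trivially on `Sh_K`), `EtaleHeckeCentralTrivial`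
(an element with identity translates acts trivially on `H¹_ét`), `UnitaryGroupFinAdelicOneLevelFinite` (`E¹·U` has finite index in
`U(1)(𝔸_{F⁺,f})`), `RepresentationBaseChangeFixedVectors` (`repBaseChange`, extension of scalars of a representation; finite-index /
open stabilisers survive it).

For the record system `S : RecordSystemGS F J⋆ ι₁ K₀` of the canonical model of the unitary Shimura curve `Sh(U(J⋆), 𝔻)`
(`hU7ₛ`, `hLQ`, `h4`, `isoₛ` as in `A3Liu418GSInstance`) and a prime `ℓ`:
* §1 `sec42HeckeTranslatesGS_tr_finAdelicCenter_rational`, **`rhoEt_etaleHeckeDatumGS_finAdelicCenter_rational`** — a RATIONAL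
  norm-one scalar `x ∈ E¹(F⁺)`, read as the central element `x·1₂ ∈ U(J⋆)(𝔸_{F⁺,f})`, acts trivially on `H¹_ét(Sh⋆_∞)` (its Hecke
  translates are `𝟙`, [Milne2005ShimuraVarieties] §5 p. 57);
* §2 **`rhoEtCenterGS`** (`u ↦ rhoEt (u·1₂)`), **`rhoEtCenterGSExt A`** (`= repBaseChange A rhoEtCenterGS`, `u ↦ 1 ⊗ rhoEt(u·1₂)` on
  `A ⊗_{ℚ_ℓ} H¹_ét`), `rhoEtCenterGS_rational`; **`exists_finiteIndex_forall_rhoEtCenterGS[Ext]_eq`** — every vector is fixed by a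
  FINITE-INDEX subgroup of the centre (`E¹(F⁺)·(Z ∩ K)`, [PlatonovRapinchuk1994] Thm. 5.1), hypothesis (b) of the central weight
  decomposition; `exists_isOpen_forall_rhoEtCenterGS[Ext]_eq` — and by an OPEN one (`Z ∩ K`); **`eq_one_of_eigenvector_rhoEtCenterGSExt`**,
  `eq_one_of_eigenvector_of_apply_eq`, `exists_isOpen_forall_eq_one_of_eigenvector` — a central character with a non-zero eigenvector
  in `A ⊗ H¹_ét` is trivial on `E¹(F⁺)` and on an open subgroup, i.e. AUTOMORPHIC and continuous: the see-saw sum of [Liu2021]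
  Thm. 4.15 runs over automorphic labels.
HC_CM is not mentioned by this file.

## References
* [Liu2021] Y. Liu, *Fourier–Jacobi cycles and arithmetic relative trace formula*, Camb. J. Math. 9 (2021): §4.2 (FJcycle.tex
  l. 2074, l. 2160; print pp. 49–50), Def. 4.11 (l. 2090), proof of Thm. 4.15 (l. 2199–2212; print pp. 50–51).
* [Milne2005ShimuraVarieties] J. S. Milne, *Introduction to Shimura varieties* (2005/2017), §5 p. 57, Thm. 13.6 p. 118.
* [PlatonovRapinchuk1994] V. Platonov, A. Rapinchuk, *Algebraic Groups and Number Theory* (1994), Thm. 5.1.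
-/

set_option autoImplicit false

noncomputable section

/-! ## §1. The rational centre `E¹(F⁺)·1₂` acts trivially on `H¹_ét` of the GS curve tower -/

namespace Summit.HodgeConjecture.CorCM.Lines.A3Liu418

open CategoryTheory CategoryTheory.Limits AlgebraicGeometry NumberField IsDedekindDomain
open Literature.AlgebraicGeometry.Motives
open Literature.AlgebraicGeometry.ShimuraVarieties.UnitaryCanonicalModel
open Literature.NumberTheory.Automorphic Literature.NumberTheory.Automorphic.UnitaryGroup
open Literature.NumberTheory.Automorphic.Liu2021 Literature.NumberTheory.Automorphic.Liu2021.AppendixC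
open Summit.HodgeConjecture.CorCM.Model Summit.HodgeConjecture.CorCM.Model.HComp

variable {F : CMField} {ι₁ : F →+* ℂ} {Jstar : Matrix (Fin 2) (Fin 2) F}
  {K₀ : C5.OpenCompactSubgroup ↥(finAdelic (↥(maximalRealSubfield F)) F (IsCMField.complexConj F) 2 Jstar)}
  (S : RecordSystemGS F Jstar ι₁ K₀)
  (hU7ₛ : S.HeckeTranslateDefinedOver) (hLQ : S.IsLevelQuotient) (h4 : 4 ≤ Module.finrank ℚ F) (isoₛ : ℕ → Prop)

/-- **The chosen Hecke translate of the curve datum by a RATIONAL norm-one scalar `x·1₂` is the identity of `X_K`**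
(★ `sec42HeckeTranslatesGS_tr` = base change of the chosen record translate; ★-new `RecordSystemGS.heckeTranslate_eq_id_of_rational_central`).
[cite: Milne2005ShimuraVarieties, §5 p. 57 and Thm. 13.6 p. 118] [cite: Liu2021, §4.2 and proof of Thm. 4.15 (l. 2199–2212)] -/
theorem sec42HeckeTranslatesGS_tr_finAdelicCenter_rational (K : C5.SmallLevel K₀) (x : (F : Type)ˣ)
    (hx : Units.map (algebraMap (F : Type) (FiniteAdeleRing (𝓞 (F : Type)) (F : Type))).toMonoidHom x ∈
      finAdelicOne (↥(maximalRealSubfield (F : Type))) (F : Type) (IsCMField.complexConj (F : Type))) :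
    (sec42HeckeTranslatesGS S hU7ₛ h4 isoₛ).tr
        (finAdelicCenter (↥(maximalRealSubfield (F : Type))) (F : Type) (IsCMField.complexConj (F : Type)) 2 Jstar ⟨_, hx⟩) K K
        (heckeLE_finAdelicCenter K ⟨_, hx⟩) = 𝟙 _ := by
  rw [sec42HeckeTranslatesGS_tr,
    S.heckeTranslate_eq_id_of_rational_central x hx (isHeckeTranslate_recordHeckeTranslateGS S hU7ₛ _ K K _),
    CategoryTheory.Functor.map_id]
  rfl

/-- **The rational centre acts trivially on `H¹_ét` of the GS curve tower**: for a rational norm-one scalar `x ∈ F`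
(`x ∈ E¹(F⁺)`, read as the central element `x·1₂ ∈ U(J⋆)(𝔸_{F⁺,f})`), `rhoEt (x·1₂) = 1` on `(etaleHeckeDatumGS …)` — the
«`Z(ℚ)` acts trivially» clause that makes the central characters occurring in `H¹_ét(Sh⋆)` AUTOMORPHIC (`IsAutomorphicOneChar`).
[cite: Liu2021, proof of Thm. 4.15 (FJcycle.tex l. 2199–2212); Def. 4.11 (l. 2090)] [cite: Milne2005ShimuraVarieties, §5 p. 57] -/
theorem rhoEt_etaleHeckeDatumGS_finAdelicCenter_rational (ℓ : ℕ) [Fact ℓ.Prime] (x : (F : Type)ˣ)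
    (hx : Units.map (algebraMap (F : Type) (FiniteAdeleRing (𝓞 (F : Type)) (F : Type))).toMonoidHom x ∈
      finAdelicOne (↥(maximalRealSubfield (F : Type))) (F : Type) (IsCMField.complexConj (F : Type)))
    (y : (sec42DataGS S h4 isoₛ).etaleH1Tower ℓ) :
    (etaleHeckeDatumGS S hU7ₛ hLQ h4 isoₛ ℓ).rhoEt
        (finAdelicCenter (↥(maximalRealSubfield (F : Type))) (F : Type) (IsCMField.complexConj (F : Type)) 2 Jstar ⟨_, hx⟩) y = y :=
  EtaleHeckeDatum.rhoEt_eq_self_of_isInducedBy_of_tr_eq_id (isInducedBy_etaleHeckeDatumGS S hU7ₛ hLQ h4 isoₛ ℓ)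
    (fun K => heckeLE_finAdelicCenter K ⟨_, hx⟩)
    (fun K => sec42HeckeTranslatesGS_tr_finAdelicCenter_rational S hU7ₛ h4 isoₛ K x hx) y

end Summit.HodgeConjecture.CorCM.Lines.A3Liu418

/-! ## §2. The central torus action on `A ⊗ H¹_ét` of the GS curve tower: finite-index and open stabilisers, automorphic support -/

namespace Summit.HodgeConjecture.CorCM.Lines.A3Liu418

open CategoryTheory CategoryTheory.Limits AlgebraicGeometry NumberField IsDedekindDomain
open scoped TensorProduct
open Literature.AlgebraicGeometry.Motives
open Literature.AlgebraicGeometry.ShimuraVarieties.UnitaryCanonicalModel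
open Literature.NumberTheory.Automorphic Literature.NumberTheory.Automorphic.UnitaryGroup
open Literature.NumberTheory.Automorphic.Liu2021 Literature.NumberTheory.Automorphic.Liu2021.AppendixC
open Summit.HodgeConjecture.CorCM.Model Summit.HodgeConjecture.CorCM.Model.HComp
open Literature.RepresentationTheory

variable {F : CMField} {ι₁ : F →+* ℂ} {Jstar : Matrix (Fin 2) (Fin 2) F}
  {K₀ : C5.OpenCompactSubgroup ↥(finAdelic (↥(maximalRealSubfield F)) F (IsCMField.complexConj F) 2 Jstar)}
  (S : RecordSystemGS F Jstar ι₁ K₀)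
  (hU7ₛ : S.HeckeTranslateDefinedOver) (hLQ : S.IsLevelQuotient) (h4 : 4 ≤ Module.finrank ℚ F) (isoₛ : ℕ → Prop)
  (ℓ : ℕ) [Fact ℓ.Prime]

/-- **The action of the finite-adelic centre `Z = E¹(𝔸_{F⁺,f})` of `U(J⋆)(𝔸_f)` on `H¹_ét` of the GS curve tower** (`u ↦ rhoEt (u·1₂)`,
over `ℚ_ℓ`). [cite: Liu2021, §4.2 (FJcycle.tex l. 2160; print pp. 49–50) and proof of Thm. 4.15 (l. 2199–2212)] -/
def rhoEtCenterGS : Representation ℚ_[ℓ] ↥(finAdelicOne (↥(maximalRealSubfield (F : Type))) (F : Type) (IsCMField.complexConj (F : Type)))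
    ((sec42DataGS S h4 isoₛ).etaleH1Tower ℓ) :=
  (etaleHeckeDatumGS S hU7ₛ hLQ h4 isoₛ ℓ).rhoEt.comp
    (finAdelicCenter (↥(maximalRealSubfield (F : Type))) (F : Type) (IsCMField.complexConj (F : Type)) 2 Jstar)

/-- unfolding: `rhoEtCenterGS u = rhoEt (u·1₂)`. [cite: Liu2021, §4.2 (FJcycle.tex l. 2160; print pp. 49–50)] -/
theorem rhoEtCenterGS_apply (u : ↥(finAdelicOne (↥(maximalRealSubfield (F : Type))) (F : Type) (IsCMField.complexConj (F : Type)))) :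
    rhoEtCenterGS S hU7ₛ hLQ h4 isoₛ ℓ u =
      (etaleHeckeDatumGS S hU7ₛ hLQ h4 isoₛ ℓ).rhoEt
        (finAdelicCenter (↥(maximalRealSubfield (F : Type))) (F : Type) (IsCMField.complexConj (F : Type)) 2 Jstar u) := rfl

/-- **Its scalar extension to `A ⊗_{ℚ_ℓ} H¹_ét`** for a commutative `ℚ_ℓ`-algebra `A` (the consumer takes `A := ℚ_ℓ^{ac}`, the
module on which `omegaHom` values live), `u ↦ rhoEt(u·1₂) ⊗ 1`.  Stated for a general `A` so that no algebraic-closure instance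
enters the elaboration of the bookkeeping below. [cite: Liu2021, §4.2 (FJcycle.tex l. 2160–2165; print pp. 49–50)] -/
def rhoEtCenterGSExt (A : Type*) [CommRing A] [Algebra ℚ_[ℓ] A] :
    Representation A ↥(finAdelicOne (↥(maximalRealSubfield (F : Type))) (F : Type) (IsCMField.complexConj (F : Type)))
      (A ⊗[ℚ_[ℓ]] (sec42DataGS S h4 isoₛ).etaleH1Tower ℓ) :=
  IntertwiningBaseChange.repBaseChange A (rhoEtCenterGS S hU7ₛ hLQ h4 isoₛ ℓ)

/-- on pure tensors: `rhoEtCenterGSExt A u (a ⊗ y) = a ⊗ rhoEt (u·1₂) y`. [cite: Liu2021, §4.2 (FJcycle.tex l. 2160–2165; print pp. 49–50)] -/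
theorem rhoEtCenterGSExt_tmul (A : Type*) [CommRing A] [Algebra ℚ_[ℓ] A]
    (u : ↥(finAdelicOne (↥(maximalRealSubfield (F : Type))) (F : Type) (IsCMField.complexConj (F : Type)))) (a : A)
    (y : (sec42DataGS S h4 isoₛ).etaleH1Tower ℓ) :
    rhoEtCenterGSExt S hU7ₛ hLQ h4 isoₛ ℓ A u (a ⊗ₜ[ℚ_[ℓ]] y) = a ⊗ₜ[ℚ_[ℓ]] rhoEtCenterGS S hU7ₛ hLQ h4 isoₛ ℓ u y := rfl

/-- the rational centre acts trivially through `rhoEtCenterGS` (G2b (3), restated on the central action).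
[cite: Liu2021, proof of Thm. 4.15 (FJcycle.tex l. 2199–2212)] -/
theorem rhoEtCenterGS_rational (x : (F : Type)ˣ)
    (hx : Units.map (algebraMap (F : Type) (FiniteAdeleRing (𝓞 (F : Type)) (F : Type))).toMonoidHom x ∈
      finAdelicOne (↥(maximalRealSubfield (F : Type))) (F : Type) (IsCMField.complexConj (F : Type)))
    (y : (sec42DataGS S h4 isoₛ).etaleH1Tower ℓ) : rhoEtCenterGS S hU7ₛ hLQ h4 isoₛ ℓ ⟨_, hx⟩ y = y :=
  rhoEt_etaleHeckeDatumGS_finAdelicCenter_rational S hU7ₛ hLQ h4 isoₛ ℓ x hx y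

/-- the stabiliser of a vector under a representation, as a subgroup. [folklore] -/
private def stabSubgroup {k G V : Type*} [CommSemiring k] [Group G] [AddCommMonoid V] [Module k V] (ρ : Representation k G V)
    (v : V) : Subgroup G where
  carrier := {g | ρ g v = v}
  one_mem' := by simp
  mul_mem' {a b} ha hb := by
    change ρ (a * b) v = v
    rw [map_mul, Module.End.mul_apply, (show ρ b v = v from hb), (show ρ a v = v from ha)]
  inv_mem' {a} ha := by
    change ρ a⁻¹ v = v
    have h : ρ a⁻¹ (ρ a v) = v := by
      rw [← Module.End.mul_apply, ← map_mul, inv_mul_cancel, map_one, Module.End.one_apply]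
    rwa [(show ρ a v = v from ha)] at h

/-- membership in the stabiliser subgroup, unfolded. [folklore] -/
private theorem mem_stabSubgroup_iff {k G V : Type*} [CommSemiring k] [Group G] [AddCommMonoid V] [Module k V]
    (ρ : Representation k G V) (v : V) (g : G) : g ∈ stabSubgroup ρ v ↔ ρ g v = v := Iff.rfl

/-- **Every class of `H¹_ét` of the curve tower is fixed by a FINITE-INDEX subgroup of the centre `Z = E¹(𝔸_{F⁺,f})`** — namely by
`E¹(F⁺)·(Z ∩ K)` for any small level `K` fixing it (★ `EtaleHeckeDatum.smooth`; the rational centre acts trivially, G2b (3);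
finite index by the class finiteness of the anisotropic torus, G2b (1)).
[cite: Liu2021, proof of Thm. 4.15 (FJcycle.tex l. 2199–2212)] [cite: PlatonovRapinchuk1994, Thm. 5.1] -/
theorem exists_finiteIndex_forall_rhoEtCenterGS_eq (y : (sec42DataGS S h4 isoₛ).etaleH1Tower ℓ) :
    ∃ N : Subgroup ↥(finAdelicOne (↥(maximalRealSubfield (F : Type))) (F : Type) (IsCMField.complexConj (F : Type))),
      N.FiniteIndex ∧ ∀ n ∈ N, rhoEtCenterGS S hU7ₛ hLQ h4 isoₛ ℓ n y = y := by
  obtain ⟨K, hK⟩ := (etaleHeckeDatumGS S hU7ₛ hLQ h4 isoₛ ℓ).smooth y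
  -- the level `K` read in `U(J⋆)(𝔸_{F⁺,f})` (the group of the GS datum is this group, definitionally)
  let Kc : Subgroup ↥(finAdelic (↥(maximalRealSubfield (F : Type))) (F : Type) (IsCMField.complexConj (F : Type)) 2 Jstar) := K.1.1
  have hKo : IsOpen (Kc : Set ↥(finAdelic (↥(maximalRealSubfield (F : Type))) (F : Type) (IsCMField.complexConj (F : Type)) 2 Jstar)) :=
    K.1.2.1
  let Zc := finAdelicCenter (↥(maximalRealSubfield (F : Type))) (F : Type) (IsCMField.complexConj (F : Type)) 2 Jstar
  let N : Subgroup ↥(finAdelicOne (↥(maximalRealSubfield (F : Type))) (F : Type) (IsCMField.complexConj (F : Type))) :=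
    finAdelicOneRat (↥(maximalRealSubfield (F : Type))) (F : Type) (IsCMField.complexConj (F : Type)) ⊔ Kc.comap Zc
  have hN : N.FiniteIndex := finiteIndex_finAdelicOneRat_sup_comap_finAdelicCenter_cm (F : Type) 2 Jstar Kc hKo
  refine ⟨N, hN, ?_⟩
  -- both generators lie in the stabiliser of `y`
  have hle : N ≤ stabSubgroup (rhoEtCenterGS S hU7ₛ hLQ h4 isoₛ ℓ) y := by
    refine sup_le ?_ ?_
    · rw [finAdelicOneRat, Subgroup.closure_le]
      rintro _ ⟨x, hx, rfl⟩
      rw [SetLike.mem_coe, mem_stabSubgroup_iff, rhoEtCenterGS_apply]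
      exact rhoEt_etaleHeckeDatumGS_finAdelicCenter_rational S hU7ₛ hLQ h4 isoₛ ℓ x hx y
    · intro u hu
      rw [mem_stabSubgroup_iff, rhoEtCenterGS_apply]
      exact hK _ (Subgroup.mem_comap.1 hu)
  intro n hn
  exact (mem_stabSubgroup_iff _ _ _).1 (hle hn)

/-- **The same for `A ⊗ H¹_ét`** (e.g. `ℚ_ℓ^{ac} ⊗ H¹_ét`): every vector is fixed by a finite-index subgroup of the centre (pure
tensors by the previous theorem; sums by intersecting two finite-index subgroups).  This is hypothesis (b) of the weight decomposition
(G2b (4)) at the face. [cite: Liu2021, proof of Thm. 4.15 (FJcycle.tex l. 2199–2212)] [cite: PlatonovRapinchuk1994, Thm. 5.1] -/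
theorem exists_finiteIndex_forall_rhoEtCenterGSExt_eq (A : Type*) [CommRing A] [Algebra ℚ_[ℓ] A]
    (v : A ⊗[ℚ_[ℓ]] (sec42DataGS S h4 isoₛ).etaleH1Tower ℓ) :
    ∃ N : Subgroup ↥(finAdelicOne (↥(maximalRealSubfield (F : Type))) (F : Type) (IsCMField.complexConj (F : Type))),
      N.FiniteIndex ∧ ∀ n ∈ N, rhoEtCenterGSExt S hU7ₛ hLQ h4 isoₛ ℓ A n v = v := by
  exact IntertwiningBaseChange.exists_finiteIndex_forall_repBaseChange_eq A (rhoEtCenterGS S hU7ₛ hLQ h4 isoₛ ℓ)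
    (exists_finiteIndex_forall_rhoEtCenterGS_eq S hU7ₛ hLQ h4 isoₛ ℓ) v

/-- **Automorphic support**: a character `ψ` of the finite-adelic centre having a NON-ZERO `ψ`-eigenvector in `A ⊗ H¹_ét` of the curve
tower (`A` a commutative `ℚ_ℓ`-algebra without zero divisors on the module, e.g. the field `ℚ_ℓ^{ac}`) is trivial on every rational
norm-one `(x)`, `x ∈ E¹(F⁺)` — the triviality clause of ★ `IsAutomorphicOneChar` (the rational centre acts trivially, G2b (3)).
Hence only AUTOMORPHIC central characters occur, which is why the see-saw sum of [Liu2021] Thm. 4.15 runs over automorphic labels.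
[cite: Liu2021, proof of Thm. 4.15 (FJcycle.tex l. 2199–2212); Def. 4.11 (l. 2090)] -/
theorem eq_one_of_eigenvector_rhoEtCenterGSExt (A : Type*) [Field A] [Algebra ℚ_[ℓ] A]
    (ψ : ↥(finAdelicOne (↥(maximalRealSubfield (F : Type))) (F : Type) (IsCMField.complexConj (F : Type))) →* Aˣ)
    {w : A ⊗[ℚ_[ℓ]] (sec42DataGS S h4 isoₛ).etaleH1Tower ℓ} (hw0 : w ≠ 0)
    (hw : ∀ u, rhoEtCenterGSExt S hU7ₛ hLQ h4 isoₛ ℓ A u w = ((ψ u : Aˣ) : A) • w)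
    (x : (F : Type)ˣ)
    (hx : Units.map (algebraMap (F : Type) (FiniteAdeleRing (𝓞 (F : Type)) (F : Type))).toMonoidHom x ∈
      finAdelicOne (↥(maximalRealSubfield (F : Type))) (F : Type) (IsCMField.complexConj (F : Type))) :
    ψ ⟨_, hx⟩ = 1 := by
  exact IntertwiningBaseChange.eq_one_of_smul_eq_of_apply_eq_self (rhoEtCenterGSExt S hU7ₛ hLQ h4 isoₛ ℓ A) ψ hw0 hw
    (IntertwiningBaseChange.repBaseChange_eq_self_of_forall_eq_self A (rhoEtCenterGS S hU7ₛ hLQ h4 isoₛ ℓ)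
      (rhoEtCenterGS_rational S hU7ₛ hLQ h4 isoₛ ℓ x hx) w)

/-- **Every class of `H¹_ét` is fixed by an OPEN subgroup of the centre** (`Z ∩ K` for a small level `K` fixing it; ★
`EtaleHeckeDatum.smooth`, ★ `continuous_finAdelicCenter`). [cite: Liu2021, §4.2 (FJcycle.tex l. 2160: «admissible»; print pp. 49–50)] -/
theorem exists_isOpen_forall_rhoEtCenterGS_eq (y : (sec42DataGS S h4 isoₛ).etaleH1Tower ℓ) :
    ∃ U : Subgroup ↥(finAdelicOne (↥(maximalRealSubfield (F : Type))) (F : Type) (IsCMField.complexConj (F : Type))),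
      IsOpen (U : Set ↥(finAdelicOne (↥(maximalRealSubfield (F : Type))) (F : Type) (IsCMField.complexConj (F : Type)))) ∧
        ∀ n ∈ U, rhoEtCenterGS S hU7ₛ hLQ h4 isoₛ ℓ n y = y := by
  obtain ⟨K, hK⟩ := (etaleHeckeDatumGS S hU7ₛ hLQ h4 isoₛ ℓ).smooth y
  let Kc : Subgroup ↥(finAdelic (↥(maximalRealSubfield (F : Type))) (F : Type) (IsCMField.complexConj (F : Type)) 2 Jstar) := K.1.1
  have hKo : IsOpen (Kc : Set ↥(finAdelic (↥(maximalRealSubfield (F : Type))) (F : Type) (IsCMField.complexConj (F : Type)) 2 Jstar)) :=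
    K.1.2.1
  refine ⟨Kc.comap (finAdelicCenter (↥(maximalRealSubfield (F : Type))) (F : Type) (IsCMField.complexConj (F : Type)) 2 Jstar),
    hKo.preimage (continuous_finAdelicCenter (↥(maximalRealSubfield (F : Type))) (F : Type) (IsCMField.complexConj (F : Type)) 2 Jstar),
    fun u hu => ?_⟩
  rw [rhoEtCenterGS_apply]
  exact hK _ (Subgroup.mem_comap.1 hu)

/-- the same for `A ⊗ H¹_ét`: every vector is fixed by an OPEN subgroup of the centre. [cite: Liu2021, §4.2 (FJcycle.tex l. 2160; print pp. 49–50)] -/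
theorem exists_isOpen_forall_rhoEtCenterGSExt_eq (A : Type*) [CommRing A] [Algebra ℚ_[ℓ] A]
    (v : A ⊗[ℚ_[ℓ]] (sec42DataGS S h4 isoₛ).etaleH1Tower ℓ) :
    ∃ U : Subgroup ↥(finAdelicOne (↥(maximalRealSubfield (F : Type))) (F : Type) (IsCMField.complexConj (F : Type))),
      IsOpen (U : Set ↥(finAdelicOne (↥(maximalRealSubfield (F : Type))) (F : Type) (IsCMField.complexConj (F : Type)))) ∧
        ∀ n ∈ U, rhoEtCenterGSExt S hU7ₛ hLQ h4 isoₛ ℓ A n v = v := by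
  exact IntertwiningBaseChange.exists_isOpen_forall_repBaseChange_eq A (rhoEtCenterGS S hU7ₛ hLQ h4 isoₛ ℓ)
    (exists_isOpen_forall_rhoEtCenterGS_eq S hU7ₛ hLQ h4 isoₛ ℓ) v

/-- an element acting trivially on a NON-ZERO `ψ`-eigenvector is killed by `ψ` (over a field `A`). [folklore] -/
theorem eq_one_of_eigenvector_of_apply_eq (A : Type*) [Field A] [Algebra ℚ_[ℓ] A]
    (ψ : ↥(finAdelicOne (↥(maximalRealSubfield (F : Type))) (F : Type) (IsCMField.complexConj (F : Type))) →* Aˣ)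
    {w : A ⊗[ℚ_[ℓ]] (sec42DataGS S h4 isoₛ).etaleH1Tower ℓ} (hw0 : w ≠ 0)
    (hw : ∀ u, rhoEtCenterGSExt S hU7ₛ hLQ h4 isoₛ ℓ A u w = ((ψ u : Aˣ) : A) • w)
    {u : ↥(finAdelicOne (↥(maximalRealSubfield (F : Type))) (F : Type) (IsCMField.complexConj (F : Type)))}
    (hu : rhoEtCenterGSExt S hU7ₛ hLQ h4 isoₛ ℓ A u w = w) : ψ u = 1 := by
  exact IntertwiningBaseChange.eq_one_of_smul_eq_of_apply_eq_self (rhoEtCenterGSExt S hU7ₛ hLQ h4 isoₛ ℓ A) ψ hw0 hw hu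

/-- **Occurring central characters are locally constant**: a character `ψ` with a non-zero `ψ`-eigenvector in `A ⊗ H¹_ét` is
trivial on an OPEN subgroup of the finite-adelic centre (hence continuous for any topology on the values) — the continuity clause
of ★ `IsAutomorphicOneChar`. [cite: Liu2021, Def. 4.11 (l. 2090) and §4.2 (l. 2160; print pp. 49–50)] -/
theorem exists_isOpen_forall_eq_one_of_eigenvector (A : Type*) [Field A] [Algebra ℚ_[ℓ] A]
    (ψ : ↥(finAdelicOne (↥(maximalRealSubfield (F : Type))) (F : Type) (IsCMField.complexConj (F : Type))) →* Aˣ)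
    {w : A ⊗[ℚ_[ℓ]] (sec42DataGS S h4 isoₛ).etaleH1Tower ℓ} (hw0 : w ≠ 0)
    (hw : ∀ u, rhoEtCenterGSExt S hU7ₛ hLQ h4 isoₛ ℓ A u w = ((ψ u : Aˣ) : A) • w) :
    ∃ U : Subgroup ↥(finAdelicOne (↥(maximalRealSubfield (F : Type))) (F : Type) (IsCMField.complexConj (F : Type))),
      IsOpen (U : Set ↥(finAdelicOne (↥(maximalRealSubfield (F : Type))) (F : Type) (IsCMField.complexConj (F : Type)))) ∧
        ∀ u ∈ U, ψ u = 1 := by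
  obtain ⟨U, hU, h⟩ := exists_isOpen_forall_rhoEtCenterGSExt_eq S hU7ₛ hLQ h4 isoₛ ℓ A w
  exact ⟨U, hU, fun u hu => eq_one_of_eigenvector_of_apply_eq S hU7ₛ hLQ h4 isoₛ ℓ A ψ hw0 hw (h u hu)⟩

end Summit.HodgeConjecture.CorCM.Lines.A3Liu418

end
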